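import Literature.NumberTheory.EllipticCurves.ZpExtensionEisensteinDVRSettingH4TransferAdjointProofs
import HarnessLib

/-!
# H.4 at the places `v ∣ p` for the curve's Eisenstein setting, IX♭: the projection formula along the two-index maps, MIRROR
# variance (`hAdj′` / `hAdj0` of the `X`-side of (EXACT-REP))

`Proofs` file (theorems only; no definition, no named fact, no instance, no `sorry`).  Sequel of
`ZpExtensionEisensteinDVRSettingH4TransferAdjointProofs` (x9-p1-w2), which carries the projection formula along the transfers
`F = eisensteinTwistTorsionTransfer` in the variance needed by the `Y`-side instance of
`Tower.exists_sub_pow_smul_forall_pairing_eq_zero` (`X_j = H¹(K_v, T^{(j)})` with its cores, `Y_j = H¹(K_v, Tw T^{(j)})`):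
`H²(ι(1)) (x ∪_a H¹(Tw F (b+1) (a+1)) w) = H¹(F (a+1) (b+1)) x ∪_b w`.

The `X`-side instance (the towers exchanged, pairings `B_j.flip`: `X_j = H¹(K_v, Tw T^{(j)})` with the transported cores,
`Y_j = H¹(K_v, T^{(j)})`) needs the MIRROR variance, proved here for ANY H.4 data `D k` over `A_{m,k+1}` with the reduction
identity `he_red`, ANY value map `ι : A_{m,a+1} → A_{m,b+1}` with `ι ∘ reduce = p^{b−a} ·`, free indices `a ≤ b`, any place `v`:

* `eisensteinTower_localCup_transfer_adjoint_left'` — `H²(ι(1)) (H¹(F (b+1) (a+1)) x ∪_a w) = x ∪_b H¹(Tw F (a+1) (b+1)) w`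
  (`DualityDatum.localCup_map_adjoint` (Adj) with the coefficient identity `eisensteinTower_apply_e_transfer_left`) — the `hAdj′`
  input of the flipped instance at `(a, b) := (i, k+1+i)`;
* `eisensteinTower_localCup_transfer_eq_zero_of_eq_zero_left` — the weak form `H¹(F (b+1) (a+1)) x ∪_a w = 0 →
  x ∪_b H¹(Tw F (a+1) (b+1)) w = 0` — the `hAdj0` input at `(a, b) := (k, k+1+i)`.

Cell `pub/bsd-print-x9` (shared μ-crux `MuInequalityCoherentPairOfPrintCG`, STUB A `stub_exactAtP`, (EXACT-REP-INST) `X`-side).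
No summit statement is proved here; BSD is not proved by any of this.  References: [Howard2004HeegnerKolyvagin] Def. 1.1.3, §1.3
H.4, §1.6 (arXiv:1202.6340 p. 5, p. 7 L78–82, p. 11 L33–38); [NeukirchSchmidtWingberg2008] I §4 (1.4.2)–(1.4.6).
-/

set_option autoImplicit false

noncomputable section

open Function NumberField IsDedekindDomain Field CategoryTheory
open scoped NumberField ContRepresentation

namespace WeierstrassCurve

open Literature.NumberTheory.EllipticCurves Literature.NumberTheory.GaloisRepresentations
open Literature.NumberTheory.GaloisRepresentations.DiscreteGaloisModule
open Literature.NumberTheory.GaloisCohomology Literature.NumberTheory.GaloisCohomology.Howard2004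
open Literature.NumberTheory.EllipticCurves.ZpExtension (EisensteinLevel)

variable {K : Type} [Field K] [NumberField K] (W : WeierstrassCurve ℚ) [W.IsElliptic] {p : ℕ} [hp : Fact p.Prime]
  (κ : ZpExtension K p) {m : ℕ} (hm : 1 ≤ m) (cd : ConjugationDatum K)
  (D : letI := IwasawaAlgebra.isLocalRing_quotient_X_pow_add_C p hm
    ∀ k, DualityDatum p cd ((W.eisensteinTower κ hm).ρ k) (IwasawaAlgebra.EisensteinCoeff p m (k + 1)))
  (he_red : letI := IwasawaAlgebra.isLocalRing_quotient_X_pow_add_C p hm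
    ∀ k (x y : EisensteinLevel p m (fun j ↦ geomTorsion (W.baseChange K) ((p : ℤ) ^ j)) (k + 1 + 1)),
      IwasawaAlgebra.EisensteinCoeff.reduce p m (Nat.le_succ (k + 1)) ((D (k + 1)).e x y) =
        (D k).e ((W.eisensteinTower κ hm).red k x) ((W.eisensteinTower κ hm).red k y))

/-! ## The projection formula along the two-index maps, mirror variance -/

include he_red in
/-- **(Adj′) along `F`, mirror variance, free indices**: `H²(ι(1)) (H¹(F (b+1) (a+1)) x ∪_a w) = x ∪_b H¹(Tw F (a+1) (b+1)) w` for
`a ≤ b`, any value map `ι` with `ι ∘ reduce = p^{b−a} ·`, any place `v` — the `hAdj′` input of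
`Tower.exists_sub_pow_smul_forall_pairing_eq_zero` for the FLIPPED pairings (`X_j = H¹(K_v, Tw T^{(j)})`, `Y_j = H¹(K_v, T^{(j)})`).
[cite: Howard2004HeegnerKolyvagin, §1.3 H.4 (arXiv p. 7, L78–82), §1.6 (p. 11 L33–38)] [cite: NeukirchSchmidtWingberg2008, I §4 (1.4.2)–(1.4.6)] -/
theorem eisensteinTower_localCup_transfer_adjoint_left' {a b : ℕ} (hab : a ≤ b) (v : Place K)
    (ι : IwasawaAlgebra.EisensteinCoeff p m (a + 1) →+ IwasawaAlgebra.EisensteinCoeff p m (b + 1))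
    (hι : ∀ x : IwasawaAlgebra.EisensteinCoeff p m (b + 1),
      ι (IwasawaAlgebra.EisensteinCoeff.reduce p m (Nat.succ_le_succ hab) x) = p ^ (b - a) • x)
    (x : letI := IwasawaAlgebra.isLocalRing_quotient_X_pow_add_C p hm
      galoisCohomology (((W.eisensteinTower κ hm).ρ b).toLocal v) 1)
    (w : letI := IwasawaAlgebra.isLocalRing_quotient_X_pow_add_C p hm
      galoisCohomology ((cd.twist ((W.eisensteinTower κ hm).ρ a)).toLocal v) 1) :
    letI := IwasawaAlgebra.isLocalRing_quotient_X_pow_add_C p hm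
    ContinuousRep.cohomologyMap ((D a).twistOne.toLocal v) ((D b).twistOne.toLocal v) ι continuous_of_discreteTopology
        (fun _ z => (D a).twistOne_apply_of_apply_reduce (D b) _ ι (p ^ (b - a)) hι _ z) 2
        ((D a).localCup v
          (galoisCohomology.map (DiscreteGaloisModule.localMap
            ((W.baseChange K).eisensteinTwistTorsionTransfer κ hm (fun j ↦ (W.baseChange K).torsionGaloisModuleReduce p j)
              (W.torsionGaloisModuleReduce_coe (K := K) (p := p)) (b + 1) (a + 1)) v) 1 x) w) =
      (D b).localCup v x
        (galoisCohomology.map (DiscreteGaloisModule.localMap (DiscreteGaloisModule.restrictMap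
          ((W.baseChange K).eisensteinTwistTorsionTransfer κ hm (fun j ↦ (W.baseChange K).torsionGaloisModuleReduce p j)
            (W.torsionGaloisModuleReduce_coe (K := K) (p := p)) (a + 1) (b + 1)) cd.conj) v) 1 w) := by
  letI := IwasawaAlgebra.isLocalRing_quotient_X_pow_add_C p hm
  let F := (W.baseChange K).eisensteinTwistTorsionTransfer κ hm
    (fun j ↦ (W.baseChange K).torsionGaloisModuleReduce p j) (W.torsionGaloisModuleReduce_coe (K := K) (p := p))
  exact (D a).localCup_map_adjoint (D b) ((F (b + 1) (a + 1)).toContinuousLinearMap.toLinearMap.toAddMonoidHom)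
    (fun g z => congrArg (fun φ ↦ φ z) ((F (b + 1) (a + 1)).isIntertwining' g))
    ((F (a + 1) (b + 1)).toContinuousLinearMap.toLinearMap.toAddMonoidHom)
    (fun g z => congrArg (fun φ ↦ φ z) ((F (a + 1) (b + 1)).isIntertwining' g)) ι
    (fun g z => (D a).twistOne_apply_of_apply_reduce (D b) _ ι (p ^ (b - a)) hι g z)
    (fun s t => W.eisensteinTower_apply_e_transfer_left κ hm cd D he_red hab ι hι s t) v x w

include he_red in
/-- **(Adj′) along `F`, mirror variance, weak form**: `H¹(F (b+1) (a+1)) x ∪_a w = 0 → x ∪_b H¹(Tw F (a+1) (b+1)) w = 0` — the `hAdj0`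
input of `Tower.exists_sub_pow_smul_forall_pairing_eq_zero` for the FLIPPED pairings (value maps exist:
`EisensteinCoeff.exists_addMonoidHom_apply_reduce_eq_pow_smul`).
[cite: Howard2004HeegnerKolyvagin, §1.3 H.4 (arXiv p. 7, L78–82), §1.6 (p. 11 L33–38)] [cite: NeukirchSchmidtWingberg2008, I §4 (1.4.2)] -/
theorem eisensteinTower_localCup_transfer_eq_zero_of_eq_zero_left {a b : ℕ} (hab : a ≤ b) (v : Place K)
    (x : letI := IwasawaAlgebra.isLocalRing_quotient_X_pow_add_C p hm
      galoisCohomology (((W.eisensteinTower κ hm).ρ b).toLocal v) 1)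
    (w : letI := IwasawaAlgebra.isLocalRing_quotient_X_pow_add_C p hm
      galoisCohomology ((cd.twist ((W.eisensteinTower κ hm).ρ a)).toLocal v) 1)
    (h0 : letI := IwasawaAlgebra.isLocalRing_quotient_X_pow_add_C p hm
      (D a).localCup v
          (galoisCohomology.map (DiscreteGaloisModule.localMap
            ((W.baseChange K).eisensteinTwistTorsionTransfer κ hm (fun j ↦ (W.baseChange K).torsionGaloisModuleReduce p j)
              (W.torsionGaloisModuleReduce_coe (K := K) (p := p)) (b + 1) (a + 1)) v) 1 x) w = 0) :
    letI := IwasawaAlgebra.isLocalRing_quotient_X_pow_add_C p hm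
    (D b).localCup v x
        (galoisCohomology.map (DiscreteGaloisModule.localMap (DiscreteGaloisModule.restrictMap
          ((W.baseChange K).eisensteinTwistTorsionTransfer κ hm (fun j ↦ (W.baseChange K).torsionGaloisModuleReduce p j)
            (W.torsionGaloisModuleReduce_coe (K := K) (p := p)) (a + 1) (b + 1)) cd.conj) v) 1 w) = 0 := by
  letI := IwasawaAlgebra.isLocalRing_quotient_X_pow_add_C p hm
  obtain ⟨ι, hι⟩ := IwasawaAlgebra.EisensteinCoeff.exists_addMonoidHom_apply_reduce_eq_pow_smul (p := p) m
    (Nat.succ_le_succ hab)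
  have hι' : ∀ y : IwasawaAlgebra.EisensteinCoeff p m (b + 1),
      ι (IwasawaAlgebra.EisensteinCoeff.reduce p m (Nat.succ_le_succ hab) y) = p ^ (b - a) • y := fun y ↦ by
    rw [hι, Nat.succ_sub_succ]
  rw [← W.eisensteinTower_localCup_transfer_adjoint_left' κ hm cd D he_red hab v ι hι' x w, h0]
  exact map_zero _

end WeierstrassCurve

end
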